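import Mathlib
import Literature.MathematicalPhysics.StatisticalMechanics.BarlowStacking

/-!
# Route `PhononSlackCertificates`, crux `NearFieldConvexity` (stmt-AtomisticToContinuum-13958), line `Sketch`:
stub `stub_chartSites` (S3, template sites)

In the IDEAL Barlow template `barlowPos 1 (√6/3) s` (unit in-plane spacing, ideal layer height
`√6/3 = √(2/3)`, arbitrary Hägg word `s`), every site of norm `≤ 43/20` is the origin or lies within
`3/2` of a CENTRAL site (a site `c` with `0 < ‖c‖ ≤ 3/2`; these are the 18 two-shell neighbours of
the origin, at norms `1` and `√2`).

Proof.  With `L m := haggLabel s m`,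
`12 · ‖barlowPos 1 (√6/3) s m u v − barlowPos 1 (√6/3) s m' u' v'‖²` is the INTEGER
`3 (2(u−u') + (v−v') + (L m − L m'))² + (3(v−v') + (L m − L m'))² + 8 (m−m')²`
(`chartSites_normSq_sub_eq`, from `dist_barlowPos_sq`, `√3² = 3`, `√6² = 6`; the site `(0,0,0)` is
the origin), so the three norm conditions `‖·‖ ≤ 43/20`, `0 < ‖·‖ ≤ 3/2`, `‖· − ·‖ ≤ 3/2` become the
integer conditions `N ≤ 55`, `1 ≤ N' ≤ 27`, `D ≤ 27`.  `N ≤ 55` forces `|m| ≤ 2`, `|v| ≤ 3`,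
`|u| ≤ 5`, and the Hägg word enters only through the letter values `L 0 = 0`, `L (±1) ∈ {±1}`,
`L (±2) − L (±1) ∈ {±1}` (`haggLabel_succ`, `IsHaggSeq`).  The resulting finite integer statements —
layer `0` ↦ a unit site of layer `0` (`chartSites_core0`), layers `±1` ↦ a central site of the same
layer (`chartSites_core1`), layers `±2` ↦ a central site of layer `±1` (`chartSites_core2`) — are
checked by `decide`.
-/

noncomputable section

open Literature.MathematicalPhysics.StatisticalMechanics

namespace Summit.AtomisticToContinuum.Crystallization.Theorems.PhononSlackNearFieldConvexity

/-! ### Integer cores (kernel `decide`) -/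

/-- Layer `0` (letter `L = 0`): a triangular-lattice site with `12 · norm² ≤ 55` is the origin or
within `12 · dist² ≤ 27` of a unit site. [folklore] -/
theorem chartSites_core0 :
    ∀ L ∈ Finset.Icc (0 : ℤ) 0, ∀ u ∈ Finset.Icc (-5 : ℤ) 5, ∀ v ∈ Finset.Icc (-3 : ℤ) 3,
      3 * (2 * u + v + L) ^ 2 + (3 * v + L) ^ 2 + 8 * (0 : ℤ) ^ 2 ≤ 55 →
      (u = 0 ∧ v = 0) ∨ ∃ u' ∈ Finset.Icc (-2 : ℤ) 2, ∃ v' ∈ Finset.Icc (-2 : ℤ) 2,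
        1 ≤ 3 * (2 * u' + v' + L) ^ 2 + (3 * v' + L) ^ 2 + 8 * (0 : ℤ) ^ 2 ∧
        3 * (2 * u' + v' + L) ^ 2 + (3 * v' + L) ^ 2 + 8 * (0 : ℤ) ^ 2 ≤ 27 ∧
        3 * (2 * (u - u') + (v - v') + (L - L)) ^ 2 + (3 * (v - v') + (L - L)) ^ 2 +
          8 * ((0 : ℤ) - 0) ^ 2 ≤ 27 := by
  decide

/-- Layers `±1` (letter `L ∈ {±1}`): a site with `12 · norm² ≤ 55` is within `12 · dist² ≤ 27` of a
central site of the same layer. [folklore] -/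
theorem chartSites_core1 :
    ∀ m ∈ Finset.Icc (-1 : ℤ) 1, (m = 1 ∨ m = -1) →
      ∀ L ∈ Finset.Icc (-1 : ℤ) 1, (L = 1 ∨ L = -1) →
      ∀ u ∈ Finset.Icc (-5 : ℤ) 5, ∀ v ∈ Finset.Icc (-3 : ℤ) 3,
      3 * (2 * u + v + L) ^ 2 + (3 * v + L) ^ 2 + 8 * m ^ 2 ≤ 55 →
      ∃ u' ∈ Finset.Icc (-2 : ℤ) 2, ∃ v' ∈ Finset.Icc (-2 : ℤ) 2,
        1 ≤ 3 * (2 * u' + v' + L) ^ 2 + (3 * v' + L) ^ 2 + 8 * m ^ 2 ∧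
        3 * (2 * u' + v' + L) ^ 2 + (3 * v' + L) ^ 2 + 8 * m ^ 2 ≤ 27 ∧
        3 * (2 * (u - u') + (v - v') + (L - L)) ^ 2 + (3 * (v - v') + (L - L)) ^ 2 +
          8 * (m - m) ^ 2 ≤ 27 := by
  decide

/-- Layers `m = ±2` (letters `L1 = L (m/2) ∈ {±1}`, `L2 = L m = L1 ± 1`): a site with
`12 · norm² ≤ 55` is within `12 · dist² ≤ 27` of a central site of layer `m' = m/2`. [folklore] -/
theorem chartSites_core2 :
    ∀ m ∈ Finset.Icc (-2 : ℤ) 2, ∀ m' ∈ Finset.Icc (-1 : ℤ) 1,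
      ∀ L1 ∈ Finset.Icc (-1 : ℤ) 1, ∀ L2 ∈ Finset.Icc (-2 : ℤ) 2,
      ((m = 2 ∧ m' = 1) ∨ (m = -2 ∧ m' = -1)) ∧ (L1 = 1 ∨ L1 = -1) ∧ (L2 - L1 = 1 ∨ L2 - L1 = -1) →
      ∀ u ∈ Finset.Icc (-5 : ℤ) 5, ∀ v ∈ Finset.Icc (-3 : ℤ) 3,
      3 * (2 * u + v + L2) ^ 2 + (3 * v + L2) ^ 2 + 8 * m ^ 2 ≤ 55 →
      ∃ u' ∈ Finset.Icc (-2 : ℤ) 2, ∃ v' ∈ Finset.Icc (-2 : ℤ) 2,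
        1 ≤ 3 * (2 * u' + v' + L1) ^ 2 + (3 * v' + L1) ^ 2 + 8 * m' ^ 2 ∧
        3 * (2 * u' + v' + L1) ^ 2 + (3 * v' + L1) ^ 2 + 8 * m' ^ 2 ≤ 27 ∧
        3 * (2 * (u - u') + (v - v') + (L2 - L1)) ^ 2 + (3 * (v - v') + (L2 - L1)) ^ 2 +
          8 * (m - m') ^ 2 ≤ 27 := by
  decide

/-- The ranges fed to the integer cores: `N ≤ 55` with `|L| ≤ 2` forces `|u| ≤ 5`, `|v| ≤ 3`.
[folklore] -/
theorem chartSites_bounds {u v L m : ℤ} (hL : -2 ≤ L ∧ L ≤ 2)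
    (hN : 3 * (2 * u + v + L) ^ 2 + (3 * v + L) ^ 2 + 8 * m ^ 2 ≤ 55) :
    u ∈ Finset.Icc (-5 : ℤ) 5 ∧ v ∈ Finset.Icc (-3 : ℤ) 3 := by
  have hv : (3 * v + L) ^ 2 < 8 ^ 2 := by nlinarith [sq_nonneg (2 * u + v + L), sq_nonneg m]
  have hu : (2 * u + v + L) ^ 2 < 5 ^ 2 := by nlinarith [sq_nonneg (3 * v + L), sq_nonneg m]
  obtain ⟨hv1, hv2⟩ := abs_lt_of_sq_lt_sq' hv (by norm_num)
  obtain ⟨hu1, hu2⟩ := abs_lt_of_sq_lt_sq' hu (by norm_num)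
  exact ⟨Finset.mem_Icc.2 ⟨by omega, by omega⟩, Finset.mem_Icc.2 ⟨by omega, by omega⟩⟩

/-! ### Squared norms of template sites as integers -/

/-- `12 ·` the squared distance of two ideal template sites is the integer
`3 (2Δu + Δv + ΔL)² + (3Δv + ΔL)² + 8 Δm²`. [folklore] -/
theorem chartSites_normSq_sub_eq (s : ℤ → ℤ) (m u v m' u' v' : ℤ) :
    12 * ‖barlowPos 1 (Real.sqrt 6 / 3) s m u v - barlowPos 1 (Real.sqrt 6 / 3) s m' u' v'‖ ^ 2 =
      ((3 * (2 * (u - u') + (v - v') + (haggLabel s m - haggLabel s m')) ^ 2 +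
        (3 * (v - v') + (haggLabel s m - haggLabel s m')) ^ 2 + 8 * (m - m') ^ 2 : ℤ) : ℝ) := by
  rw [← dist_eq_norm, dist_barlowPos_sq]
  have h3 : (√3 : ℝ) ^ 2 = 3 := Real.sq_sqrt (by norm_num)
  have h6 : (√6 : ℝ) ^ 2 = 6 := Real.sq_sqrt (by norm_num)
  push_cast
  linear_combination (3 * ((v : ℝ) - v' + ((haggLabel s m : ℝ) - haggLabel s m') / 3) ^ 2) * h3 +
    (4 / 3 * ((m : ℝ) - m') ^ 2) * h6

/-- `12 ·` the squared norm of an ideal template site is the integer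
`3 (2u + v + L m)² + (3v + L m)² + 8 m²`. [folklore] -/
theorem chartSites_normSq_eq (s : ℤ → ℤ) (m u v : ℤ) :
    12 * ‖barlowPos 1 (Real.sqrt 6 / 3) s m u v‖ ^ 2 =
      ((3 * (2 * u + v + haggLabel s m) ^ 2 + (3 * v + haggLabel s m) ^ 2 + 8 * m ^ 2 : ℤ) : ℝ) := by
  have h := chartSites_normSq_sub_eq s m u v 0 0 0
  have h0 : barlowPos 1 (Real.sqrt 6 / 3) s 0 0 0 = 0 := by simp [barlowPos]
  rw [h0, sub_zero] at h
  rw [h, haggLabel_zero]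
  push_cast
  ring

/-- `‖x‖ ≤ 43/20` gives `12 ‖x‖² ≤ 55` for integer `12 ‖x‖²`. [folklore] -/
theorem chartSites_int_le_of_norm_le {x : EuclideanSpace ℝ (Fin 3)} {N : ℤ}
    (hx : 12 * ‖x‖ ^ 2 = (N : ℝ)) (h : ‖x‖ ≤ 43 / 20) : N ≤ 55 := by
  have h1 : ‖x‖ ^ 2 ≤ (43 / 20) ^ 2 := pow_le_pow_left₀ (norm_nonneg _) h 2
  have h2 : (N : ℝ) < 56 := by rw [← hx]; norm_num at h1 ⊢; linarith
  have h3 : N < 56 := by exact_mod_cast h2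
  omega

/-- `12 ‖x‖² ≤ 27` gives `‖x‖ ≤ 3/2`. [folklore] -/
theorem chartSites_norm_le {x : EuclideanSpace ℝ (Fin 3)} {N : ℤ}
    (hx : 12 * ‖x‖ ^ 2 = (N : ℝ)) (h : N ≤ 27) : ‖x‖ ≤ 3 / 2 := by
  have h1 : (N : ℝ) ≤ 27 := by exact_mod_cast h
  have h2 : ‖x‖ ^ 2 ≤ (3 / 2) ^ 2 := by rw [← hx] at h1; norm_num; linarith
  exact (pow_le_pow_iff_left₀ (norm_nonneg _) (by norm_num) two_ne_zero).1 h2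

/-- `1 ≤ 12 ‖x‖²` gives `0 < ‖x‖`. [folklore] -/
theorem chartSites_norm_pos {x : EuclideanSpace ℝ (Fin 3)} {N : ℤ}
    (hx : 12 * ‖x‖ ^ 2 = (N : ℝ)) (h : 1 ≤ N) : 0 < ‖x‖ := by
  have h1 : (1 : ℝ) ≤ N := by exact_mod_cast h
  by_contra hc
  have h0 : ‖x‖ = 0 := le_antisymm (not_lt.1 hc) (norm_nonneg _)
  rw [h0] at hx
  have : (N : ℝ) = 0 := by rw [← hx]; norm_num
  linarith

/-! ### The stub -/

/-- **Stub S3 (template sites).**  In an ideal Barlow template (`barlowPos 1 (√6/3) s`, any Hägg word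
`s`) every site within `43/20` of the site `0` is `0` itself or lies within `3/2` of a CENTRAL site
(a site `c` with `0 < ‖c‖ ≤ 3/2`).  Reduction to the integer cores `chartSites_core0/1/2` through
`chartSites_normSq_eq` / `chartSites_normSq_sub_eq`; only `|m| ≤ 2` occurs, and the letters enter
through `L 0 = 0`, `L (±1) ∈ {±1}`, `L (±2) − L (±1) ∈ {±1}`. [folklore] -/
theorem stub_chartSites :
    ∀ s : ℤ → ℤ, IsHaggSeq s → ∀ m u v : ℤ, ‖barlowPos 1 (Real.sqrt 6 / 3) s m u v‖ ≤ 43 / 20 →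
      barlowPos 1 (Real.sqrt 6 / 3) s m u v = 0 ∨
        ∃ m' u' v' : ℤ, 0 < ‖barlowPos 1 (Real.sqrt 6 / 3) s m' u' v'‖ ∧ ‖barlowPos 1 (Real.sqrt 6 / 3) s m' u' v'‖ ≤ 3 / 2 ∧
          ‖barlowPos 1 (Real.sqrt 6 / 3) s m u v - barlowPos 1 (Real.sqrt 6 / 3) s m' u' v'‖ ≤ 3 / 2 := by
  intro s hs m u v hle
  have hN := chartSites_int_le_of_norm_le (chartSites_normSq_eq s m u v) hle
  have hm9 : m ^ 2 < 3 ^ 2 := by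
    nlinarith [sq_nonneg (2 * u + v + haggLabel s m), sq_nonneg (3 * v + haggLabel s m)]
  obtain ⟨hm1, hm2⟩ := abs_lt_of_sq_lt_sq' hm9 (by norm_num)
  rcases (show m = 0 ∨ (m = 1 ∨ m = -1) ∨ (m = 2 ∨ m = -2) by omega) with rfl | hm | hm
  · -- layer 0: the letter is `L 0 = 0`
    have h0 : haggLabel s 0 = 0 := haggLabel_zero s
    obtain ⟨hu, hv⟩ := chartSites_bounds (by omega) hN
    rcases chartSites_core0 (haggLabel s 0) (Finset.mem_Icc.2 ⟨by omega, by omega⟩) u hu v hv hN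
      with ⟨rfl, rfl⟩ | ⟨u', -, v', -, h1, h2, h3⟩
    · exact Or.inl (by simp [barlowPos])
    · exact Or.inr ⟨0, u', v', chartSites_norm_pos (chartSites_normSq_eq s 0 u' v') h1,
        chartSites_norm_le (chartSites_normSq_eq s 0 u' v') h2,
        chartSites_norm_le (chartSites_normSq_sub_eq s 0 u v 0 u' v') h3⟩
  · -- layers ±1: the letter is `L (±1) ∈ {±1}`; central site in the same layer
    have hL : haggLabel s m = 1 ∨ haggLabel s m = -1 := by
      rcases hm with rfl | rfl
      · have h := haggLabel_succ s 0
        norm_num at h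
        rcases hs 0 with h' | h' <;> omega
      · have h := haggLabel_succ s (-1)
        norm_num at h
        rcases hs (-1) with h' | h' <;> omega
    obtain ⟨hu, hv⟩ := chartSites_bounds (by omega) hN
    obtain ⟨u', -, v', -, h1, h2, h3⟩ := chartSites_core1 m (Finset.mem_Icc.2 ⟨by omega, by omega⟩)
      hm (haggLabel s m) (Finset.mem_Icc.2 ⟨by omega, by omega⟩) hL u hu v hv hN
    exact Or.inr ⟨m, u', v', chartSites_norm_pos (chartSites_normSq_eq s m u' v') h1,
      chartSites_norm_le (chartSites_normSq_eq s m u' v') h2,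
      chartSites_norm_le (chartSites_normSq_sub_eq s m u v m u' v') h3⟩
  · -- layers ±2: letters `L (±1) ∈ {±1}`, `L (±2) - L (±1) ∈ {±1}`; central site in layer `±1`
    obtain ⟨m', hm'⟩ : ∃ m' : ℤ, (m = 2 ∧ m' = 1) ∨ (m = -2 ∧ m' = -1) := ⟨m / 2, by omega⟩
    have hL1 : haggLabel s m' = 1 ∨ haggLabel s m' = -1 := by
      rcases hm' with ⟨rfl, rfl⟩ | ⟨rfl, rfl⟩
      · have h := haggLabel_succ s 0
        norm_num at h
        rcases hs 0 with h' | h' <;> omega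
      · have h := haggLabel_succ s (-1)
        norm_num at h
        rcases hs (-1) with h' | h' <;> omega
    have hL2 : haggLabel s m - haggLabel s m' = 1 ∨ haggLabel s m - haggLabel s m' = -1 := by
      rcases hm' with ⟨rfl, rfl⟩ | ⟨rfl, rfl⟩
      · have h := haggLabel_succ s 1
        norm_num at h
        rcases hs 1 with h' | h' <;> omega
      · have h := haggLabel_succ s (-2)
        norm_num at h
        rcases hs (-2) with h' | h' <;> omega
    obtain ⟨hu, hv⟩ := chartSites_bounds (by omega) hN
    obtain ⟨u', -, v', -, h1, h2, h3⟩ := chartSites_core2 m (Finset.mem_Icc.2 ⟨by omega, by omega⟩)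
      m' (Finset.mem_Icc.2 ⟨by omega, by omega⟩) (haggLabel s m')
      (Finset.mem_Icc.2 ⟨by omega, by omega⟩) (haggLabel s m)
      (Finset.mem_Icc.2 ⟨by omega, by omega⟩) ⟨hm', hL1, hL2⟩ u hu v hv hN
    exact Or.inr ⟨m', u', v', chartSites_norm_pos (chartSites_normSq_eq s m' u' v') h1,
      chartSites_norm_le (chartSites_normSq_eq s m' u' v') h2,
      chartSites_norm_le (chartSites_normSq_sub_eq s m u v m' u' v') h3⟩

end Summit.AtomisticToContinuum.Crystallization.Theorems.PhononSlackNearFieldConvexity
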